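import Mathlib
import Summits.ResolutionOfSingularities.ResolutionOfSingularities.Theorems.WeightedInvariantDatumToEmbeddedQuotientSingularitiesSliceUnits
import Summits.ResolutionOfSingularities.ResolutionOfSingularities.Theorems.WeightedInvariantDatumToEmbeddedQuotientSingularitiesSliceAway
import HarnessLib

/-!
# The Zariski–Luna slice at a closed point of a torus action with finite stabilisers

Topic: `Summits/ResolutionOfSingularities/ResolutionOfSingularities/Theorems`. This file proves the
registered stub `stub_qs_sliceCore` of the line `Sketch` of the crux
`Theses.WeightedInvariant.DatumToEmbedded` (statement `stmt-ResolutionOfSingularities-0572`):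
the commutative-algebra core of "the quotient of a regular scheme by a torus acting with finite
stabilisers has finite diagonalizable quotient singularities".

**Theorem** (`exists_slice`). Let `k` be a perfect field, `R` a smooth `k`-algebra graded by
`ℤʲ` (a `𝔾ₘʲ`-action on `X = Spec R`) with a homogeneous unit in every degree `e • χ`, `e ≥ 1`
(finite stabilisers), and `P` a maximal ideal of `R`. Then there are a finite abelian group `A`,
a smooth finite-type `k`-algebra `S` graded by `A`, an ÉTALE `R₀`-algebra structure on `S₀` and
a prime `t` of `S₀` lying over `P ∩ R₀` — i.e. an étale neighbourhood `Spec S₀ → Spec R₀ = X⫽𝔾ₘʲ`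
of the image of `P` which is the quotient of the smooth `Spec S` by the finite diagonalizable
group `D(A)`.

Proof (assembled from the sibling helper files `…QuotientSingularities*`):
1. `M ≤ ℤʲ` the lattice of degrees carrying a homogeneous element outside `P` (finite index,
   `…Lattice`), `b` a `ℤ`-basis (`Submodule.basisOfPid`), `uₗ ∈ R_{bₗ} ∖ P`;
2. `h ∈ R₀ ∖ P` a common multiple of the `uₗ` (`…SliceUnits`); on `L = R[1/h]` (graded by
   `awayPiece`, `…GradedLocalization`; smooth over `k`) the `uₗ` are units, there are units in
   all degrees `e • χ`, and `π : L → κ = R ⧸ P` kills every `L_χ`, `χ ∉ M`;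
3. `κ` is étale over `k` (`k` perfect), so `κ ⊗ₖ L` is smooth over `k`;
4. the slice `S = (κ ⊗ₖ L) ⧸ (1 ⊗ uₗ - π uₗ ⊗ 1)ₗ` is graded by `A = ℤʲ ⧸ M` (`…Slice`), with
   `S₀ ≅ L₀ ⊗ₖ κ` étale over `L₀` (`…SliceZero`), hence over `R₀` (`L₀ = R₀[1/h]`);
5. `S` is smooth over `k` at every prime over the base point `t ∈ Spec S₀` (twisted Euler
   derivations, `…SmoothAt`, `…SliceSmooth`), so some `s₀ ∈ S₀ ∖ t` has `S' = S[1/s₀]` smooth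
   (`…SliceSmooth`); `S'` graded by `A` with `S'₀ = S₀[1/s₀]` étale over `R₀` and the prime
   `t' ⊂ S'₀` under the base point lies over `P ∩ R₀` (`…SliceAway`).

[folklore: Luna's étale slice theorem for diagonalizable groups, Zariski-local form; cf.
Abramovich–Temkin, *Torification of diagonalizable group actions on toroidal schemes*, §5.1, and
Alper–Hall–Rydh, *A Luna étale slice theorem for algebraic stacks*]
-/

-- the summit namespace repeats `ResolutionOfSingularities` by design (mandated namespace)
set_option linter.dupNamespace false

namespace Summit.ResolutionOfSingularities.ResolutionOfSingularities.Theorems.DatumToEmbedded.QuotientSingularities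

open DirectSum TensorProduct Literature.RingTheory.GradedAlgebra

/-- **The Zariski–Luna slice at a closed point** (see the module docstring): for a smooth
`ℤʲ`-graded algebra `R` over a perfect field with homogeneous units in all degrees `e • χ` and a
maximal ideal `P`, a smooth finite-type `k`-algebra `S` graded by a finite abelian group with `S₀`
étale over `R₀` and a prime of `S₀` over `P ∩ R₀`. [folklore] -/
theorem exists_slice {k : Type} [Field k] [PerfectField k] {R : Type} [CommRing R] [Algebra k R]
    {j : ℕ} (𝓡 : (Fin j → ℤ) → Submodule k R) [GradedAlgebra 𝓡] {e : ℕ} (he : 0 < e)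
    (hunit : ∀ χ : Fin j → ℤ, ∃ u ∈ 𝓡 (e • χ), IsUnit u) (P : Ideal R) [P.IsMaximal]
    [Algebra.Smooth k R] :
    ∃ (A : Type) (_ : AddCommGroup A) (_ : Finite A) (_ : DecidableEq A) (S : Type)
      (_ : CommRing S) (_ : Algebra k S) (𝒮 : A → Submodule k S) (_ : GradedAlgebra 𝒮),
      Algebra.FiniteType k S ∧ Algebra.Smooth k S ∧
      ∃ (_ : Algebra (𝓡 0) (𝒮 0)) (_ : IsScalarTower k (𝓡 0) (𝒮 0))
        (_ : Algebra.Etale (𝓡 0) (𝒮 0)),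
        ∃ t : Ideal (𝒮 0), t.IsPrime ∧
          ∀ r : 𝓡 0, algebraMap (𝓡 0) (𝒮 0) r ∈ t ↔ (r : R) ∈ P := by
  -- Step 1: the lattice of degrees at `P` (finite index) and a `ℤ`-basis of it
  let M : Submodule ℤ (Fin j → ℤ) := degLattice 𝓡 he hunit P
  haveI : AddGroup.FG (Fin j → ℤ) := Module.Finite.iff_addGroup_fg.1 inferInstance
  haveI : Finite ((Fin j → ℤ) ⧸ M) := finite_quotient_degLattice 𝓡 he hunit P
  letI : DecidableEq ((Fin j → ℤ) ⧸ M) := Classical.decEq _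
  obtain ⟨m, b⟩ := Submodule.basisOfPid (Pi.basisFun ℤ (Fin j)) M
  -- homogeneous elements outside `P` in the degrees of the basis
  have hex : ∀ l, ∃ r ∈ 𝓡 ((b l : M) : Fin j → ℤ), r ∉ P := fun l =>
    (mem_degLattice_iff he hunit).1 (b l).2
  choose u₀ hu₀ hu₀P using hex
  -- Step 2: a degree-`0` common multiple `h ∉ P`; the localisation `L = R[1/h]`
  obtain ⟨h, hh0, hhP, hdvd⟩ := exists_mem_zero_notMem_dvd 𝓡 he hunit P u₀ hu₀ hu₀P
  let L : Type := Localization.Away h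
  let 𝓛 : (Fin j → ℤ) → Submodule k L := awayPiece 𝓡 hh0 L
  letI : GradedAlgebra 𝓛 := Classical.choice (nonempty_gradedAlgebra_awayPiece 𝓡 hh0 L)
  let u : Fin m → L := fun l => algebraMap R L (u₀ l)
  have hu : ∀ l, u l ∈ 𝓛 (b l) := fun l => algebraMap_mem_awayPiece hh0 (hu₀ l)
  have hunitL : ∀ l, IsUnit (u l) := fun l => IsLocalization.Away.isUnit_of_dvd h (hdvd l)
  have hunitL' : ∀ χ : Fin j → ℤ, ∃ w ∈ 𝓛 (e • χ), IsUnit w :=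
    exists_isUnit_awayPiece 𝓡 hunit hh0 L
  -- Step 3: the residue field `κ = R ⧸ P`, étale over the perfect field `k`, and `π : L → κ`
  letI : Field (R ⧸ P) := Ideal.Quotient.field P
  haveI : Algebra.Etale k (R ⧸ P) := etale_quotient_of_isMaximal P
  have hπh : IsUnit (Ideal.Quotient.mkₐ k P h) :=
    isUnit_iff_ne_zero.2 fun h0 => hhP (Ideal.Quotient.eq_zero_iff_mem.1 h0)
  let π : L →ₐ[k] R ⧸ P := IsLocalization.Away.liftAlgHom h hπh
  have hπ_alg : ∀ r : R, π (algebraMap R L r) = Ideal.Quotient.mk P r := fun r =>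
    IsLocalization.Away.lift_eq h hπh r
  have hπM : ∀ χ ∉ M, ∀ x ∈ 𝓛 χ, π x = 0 := fun χ hχ x hx =>
    map_eq_zero_of_not_mem_degLattice 𝓡 he hunit hh0 L P π.toRingHom
      (fun a ha => by
        change π (algebraMap R L a) = 0
        rw [hπ_alg, Ideal.Quotient.eq_zero_iff_mem]
        exact ha) hχ hx
  -- `κ ⊗ₖ L` is smooth over `k`
  haveI : Algebra.Smooth R L := Algebra.Smooth.of_isLocalization_Away h
  haveI : Algebra.Smooth k L := Algebra.Smooth.comp k R L
  haveI : Algebra.Smooth k ((R ⧸ P) ⊗[k] L) := Algebra.Smooth.comp k (R ⧸ P) ((R ⧸ P) ⊗[k] L)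
  -- Steps 4–5: the slice and its smooth invariant neighbourhood `S' = S[1/s₀]` of the base point
  obtain ⟨s₀, hs₀t, hsmooth⟩ := exists_notMem_smooth_away 𝓛 π M b u hu hunitL he hunitL' hπM
  have h₀ : sliceEval π u (s₀ : Slice k π u) ≠ 0 := fun h0 =>
    hs₀t ((mem_slicePrimeZero_iff 𝓛 π M b u hu s₀).2 h0)
  haveI := hsmooth
  -- the composite `R₀ → L₀ → S'₀`
  letI := sliceAwayZeroAlgebra 𝓛 π M b u hu (s₀ : Slice k π u) s₀.2
  letI := awayPieceZeroAlgebra 𝓡 hh0 L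
  letI alg : Algebra (𝓡 0) (sliceAwayPiece 𝓛 π M b u hu (s₀ : Slice k π u) s₀.2 0) :=
    ((algebraMap (𝓛 0) (sliceAwayPiece 𝓛 π M b u hu (s₀ : Slice k π u) s₀.2 0)).comp
      (algebraMap (𝓡 0) (𝓛 0))).toAlgebra
  haveI : IsScalarTower (𝓡 0) (𝓛 0) (sliceAwayPiece 𝓛 π M b u hu (s₀ : Slice k π u) s₀.2 0) :=
    IsScalarTower.of_algebraMap_eq fun _ => rfl
  refine ⟨(Fin j → ℤ) ⧸ M, inferInstance, inferInstance, inferInstance,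
    Localization.Away (s₀ : Slice k π u), inferInstance, inferInstance,
    sliceAwayPiece 𝓛 π M b u hu (s₀ : Slice k π u) s₀.2, inferInstance, inferInstance, hsmooth,
    alg, ?_, ?_, sliceAwayPrime 𝓛 π M b u hu (s₀ : Slice k π u) s₀.2 h₀, inferInstance,
    fun r => ?_⟩
  · -- `k → R₀ → S'₀` is the structure map
    haveI := isScalarTower_sliceAway 𝓛 π M b u hu (s₀ : Slice k π u) s₀.2
    refine IsScalarTower.of_algebraMap_eq (R := k) (S := ↥(𝓡 0))
      (A := ↥(sliceAwayPiece 𝓛 π M b u hu (s₀ : Slice k π u) s₀.2 0)) fun c => ?_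
    rw [IsScalarTower.algebraMap_apply k (𝓛 0)
      (sliceAwayPiece 𝓛 π M b u hu (s₀ : Slice k π u) s₀.2 0) c]
    exact congrArg (algebraMap (𝓛 0) (sliceAwayPiece 𝓛 π M b u hu (s₀ : Slice k π u) s₀.2 0))
      (Subtype.ext (IsScalarTower.algebraMap_apply k R L c))
  · -- `S'₀` is étale over `R₀`: `R₀ → L₀ = R₀[1/h]` and `L₀ → S'₀` are
    haveI := etale_sliceAway 𝓛 π M b u hu hunitL (s₀ : Slice k π u) s₀.2
    haveI : Algebra.Etale (𝓡 0) (𝓛 0) :=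
      haveI := isLocalization_awayPiece_zero 𝓡 hh0 L
      Algebra.Etale.of_isLocalizationAway (⟨h, hh0⟩ : 𝓡 0)
    exact Algebra.Etale.comp (𝓡 0) (𝓛 0) (sliceAwayPiece 𝓛 π M b u hu (s₀ : Slice k π u) s₀.2 0)
  · -- the prime under the base point lies over `P ∩ R₀`
    change algebraMap (𝓛 0) (sliceAwayPiece 𝓛 π M b u hu (s₀ : Slice k π u) s₀.2 0)
        (algebraMap (𝓡 0) (𝓛 0) r) ∈ sliceAwayPrime 𝓛 π M b u hu (s₀ : Slice k π u) s₀.2 h₀ ↔ _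
    rw [algebraMap_mem_sliceAwayPrime_iff]
    change π (algebraMap R L r) = 0 ↔ _
    rw [hπ_alg, Ideal.Quotient.eq_zero_iff_mem]

/-! ## Registered form -/

/-- **Registered stub `stub_qs_sliceCore`** of the crux `Theses.WeightedInvariant.DatumToEmbedded`
(line `Sketch`): the Zariski–Luna slice for a `ℤʲ`-graded smooth algebra over a perfect field with
homogeneous units in `e • ℤʲ`, at a maximal ideal. [folklore] -/
theorem stub_qs_sliceCore :
    ∀ {k : Type} [Field k] [PerfectField k] {R : Type} [CommRing R] [Algebra k R] {j : ℕ}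
      (𝓡 : (Fin j → ℤ) → Submodule k R) [GradedAlgebra 𝓡] {e : ℕ}, 0 < e →
      (∀ χ : Fin j → ℤ, ∃ u ∈ 𝓡 (e • χ), IsUnit u) →
      ∀ (P : Ideal R) [P.IsMaximal] [Algebra.Smooth k R],
      ∃ (A : Type) (_ : AddCommGroup A) (_ : Finite A) (_ : DecidableEq A) (S : Type)
        (_ : CommRing S) (_ : Algebra k S) (𝒮 : A → Submodule k S) (_ : GradedAlgebra 𝒮),
        Algebra.FiniteType k S ∧ Algebra.Smooth k S ∧
        ∃ (_ : Algebra (𝓡 0) (𝒮 0)) (_ : IsScalarTower k (𝓡 0) (𝒮 0))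
          (_ : Algebra.Etale (𝓡 0) (𝒮 0)),
          ∃ t : Ideal (𝒮 0), t.IsPrime ∧
            ∀ r : 𝓡 0, algebraMap (𝓡 0) (𝒮 0) r ∈ t ↔ (r : R) ∈ P := by
  intro k _ _ R _ _ j 𝓡 _ e he hunit P _ _
  exact exists_slice 𝓡 he hunit P

end Summit.ResolutionOfSingularities.ResolutionOfSingularities.Theorems.DatumToEmbedded.QuotientSingularities
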